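import Summits.QuantumFields.BalabanUV.Beta.GAN24.WoodburyFibreProjectorZd

/-!
# Beta / GAN24 / WoodburyFibreSbStrictPos — an2's brick (G″) kernel `Sb` is STRICTLY POSITIVE DEFINITE on the finitely supported
sources with zero block sums (the «strict positivity» item of AN2.md §16.4), at every `N ≥ 1`, exactly

Cell `pub-balaban`, β sub-cell, BINDER ROW **G-an2-4 ∕ (CONV-C)** («NOT IN PRINT; our proof attempt»), prover part **P3 = WOODBURY-FIBRE
reduction** (lineage `b2b-balaban-gan24-p3`, gen 7).  HONEST FRAMING (verbatim): discharging `BetaPertH` makes Bałaban's UV stability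
UNCONDITIONAL — a real constructive-QFT result; it is NOT the continuum limit and NOT the Clay problem.  HONEST DEPENDENCY: continuum YM
on T⁴ ⇐ BetaPertH ∧ nine spine estimates (0/9 proved); BetaPertH ⇐ (D1) ∧ (D4) ∧ CAP+tail; G-an2-4 gates asym, D1 and NE2/3/4.
`[folklore]`; 0 sorry; an2's `Beta/BiLaplaceBlockGreen` (`Sb_psd`'s energy form, `lapLapN_SbCol`, `WbAdj_bdd`, `isBlockConst_WbAdj`) and
`Beta/KKTFluctuationEnergy.tsum_mul_eq_zero_of_blockConst` are used BY NAME; nothing printed and nothing programme-internal is a hypothesis.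
NOT (CONV-C), NOT «G-an2-4 closed», NOT `BetaPertH`.

STATEMENT (`Sb_strictPos`): for a finite set `S ⊂ ℤ^{d+1}` and coefficients `a` whose extension by zero `ã` has ZERO BLOCK SUMS,
`Σ_{b,b′ ∈ S} a_b a_{b′} Sb N b b′ = 0 → ∀ b ∈ S, a_b = 0`; with an2's `Sb_psd` (`≥ 0`) this is strict positive definiteness of `Sb` on
`N(Q) ∩ (finite support)`.  PROOF: an2's energy identity gives `Σ a a Sb = ‖V‖²_{ℓ²}` with `V = Σ_b a_b L S_b` (`lapColSum`); so `V = 0`;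
applying `L` once more and (EL_b) `L(L S_b) = W_b + δ_b` gives `ã = −g` pointwise with `g = Σ_b a_b W_b` BLOCK-CONSTANT and bounded; then
`Σ_x ã(x)² = −Σ_x g(x) ã(x) = 0` by the M∕G complementarity (zero block sums of `ã`), hence `ã = 0`.  (Sources outside `N(Q)`: a block-constant
`ã` supported in `S` with `V = 0` exists iff `S` contains whole blocks — the kernel of the form is exactly the block-constant sources.)
-/

namespace Summit.QuantumFields.BalabanUV.Beta.GAN24.WoodburyFibreSbStrictPos

open Finset
open Literature.MathematicalPhysics.QuantumFieldTheory
open Literature.MathematicalPhysics.QuantumFieldTheory.Balaban1983to89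
open Beta.AffineAveraging (dz codiff₁ box toSite blockSum)
open Beta.AffineReproduction (IsBlockConst)
open Beta.KKTFluctuationEnergy (lip0 summable_mul_of_bdd summable_mul_of_bdd' tsum_mul_eq_zero_of_blockConst)
open Beta.ScalarBlockGreen (δS)
open Beta.BiLaplaceBlockKKT (Sb)
open Beta.BiLaplaceBlockGreen (SbCol lapN_SbCol_bdd_summable lapLapN_SbCol WbAdj WbAdj_bdd isBlockConst_WbAdj Sb_eq_lip0 lapColSum
  lip0_sum_left lip0_sum_right)
open WoodburyFibreLandauLimit (lap_apply lap_smul)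

noncomputable section

variable {d : ℕ}

/-! ## §1 Linearity of the lattice Laplacian over finite sums -/

/-- additivity of `L = codiff₁ ∘ dz`. [folklore] -/
theorem lap_add (f g : (Fin (d + 1) → ℤ) → ℝ) (x : Fin (d + 1) → ℤ) :
    codiff₁ (dz (fun z => f z + g z)) x = codiff₁ (dz f) x + codiff₁ (dz g) x := by
  rw [lap_apply, lap_apply, lap_apply, ← Finset.sum_add_distrib]
  exact Finset.sum_congr rfl fun μ _ => by ring

/-- `L` of the zero function vanishes. [folklore] -/
theorem lap_zero (x : Fin (d + 1) → ℤ) : codiff₁ (dz (fun _ : Fin (d + 1) → ℤ => (0 : ℝ))) x = 0 := by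
  rw [lap_apply]; simp

/-- `L` commutes with finite linear combinations. [folklore] -/
theorem lap_finset_sum {ι : Type*} (S : Finset ι) (c : ι → ℝ) (f : ι → (Fin (d + 1) → ℤ) → ℝ) (x : Fin (d + 1) → ℤ) :
    codiff₁ (dz (fun z => ∑ b ∈ S, c b * f b z)) x = ∑ b ∈ S, c b * codiff₁ (dz (f b)) x := by
  classical
  induction S using Finset.induction_on with
  | empty => simp only [Finset.sum_empty]; exact lap_zero x
  | @insert i S hi ih =>
      have e : (fun z => ∑ b ∈ insert i S, c b * f b z) = fun z => c i * f i z + ∑ b ∈ S, c b * f b z :=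
        funext fun z => Finset.sum_insert hi
      rw [e, lap_add, Finset.sum_insert hi, ih, lap_smul]

/-! ## §2 Strict positivity of `Sb` on sources with zero block sums -/

variable {n : ℕ} [NeZero n]

/-- **the energy form**: `Σ_{b,b′ ∈ S} a_b a_{b′} Sb b b′ = ⟨V, V⟩`, `V = lapColSum S a = Σ_b a_b L S_b` (the identity inside an2's `Sb_psd`,
exported). [folklore] -/
theorem Sb_form_eq_lip0 (S : Finset (Fin (d + 1) → ℤ)) (a : (Fin (d + 1) → ℤ) → ℝ) :
    ∑ b ∈ S, ∑ b' ∈ S, a b * a b' * Sb (N := n) b b' = lip0 (lapColSum (N := n) S a) (lapColSum (N := n) S a) := by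
  obtain ⟨C, _, hbdd, hsum⟩ := lapN_SbCol_bdd_summable (N := n) (d := d)
  have hVb : ∀ x, |lapColSum (N := n) S a x| ≤ ∑ b ∈ S, |a b| * C := fun x => by
    simp only [lapColSum]
    calc |∑ b ∈ S, a b * codiff₁ (dz (SbCol (N := n) b)) x|
        ≤ ∑ b ∈ S, |a b * codiff₁ (dz (SbCol (N := n) b)) x| := Finset.abs_sum_le_sum_abs _ _
      _ ≤ ∑ b ∈ S, |a b| * C := Finset.sum_le_sum fun b _ => by
          rw [abs_mul]; exact mul_le_mul_of_nonneg_left (hbdd _ x) (abs_nonneg _)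
  have hFF : ∀ b b' : Fin (d + 1) → ℤ,
      Summable (fun x => codiff₁ (dz (SbCol (N := n) b)) x * codiff₁ (dz (SbCol (N := n) b')) x) :=
    fun b b' => summable_mul_of_bdd (hbdd b) (hsum b')
  have hFV : ∀ b : Fin (d + 1) → ℤ, Summable (fun x => codiff₁ (dz (SbCol (N := n) b)) x * lapColSum (N := n) S a x) :=
    fun b => summable_mul_of_bdd' (hsum b) hVb
  have e1 : ∀ b ∈ S, ∑ b' ∈ S, a b * a b' * Sb (N := n) b b' = a b * lip0 (codiff₁ (dz (SbCol (N := n) b))) (lapColSum (N := n) S a) := by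
    intro b _
    unfold lapColSum
    rw [lip0_sum_right S a _ _ (fun b' _ => hFF b b'), Finset.mul_sum]
    refine Finset.sum_congr rfl fun b' _ => ?_
    rw [Sb_eq_lip0]; ring
  rw [Finset.sum_congr rfl e1, show lapColSum (N := n) S a = fun x => ∑ b ∈ S, a b * codiff₁ (dz (SbCol (N := n) b)) x from rfl]
  exact (lip0_sum_left S a _ _ (fun b _ => hFV b)).symm

/-- **STRICT POSITIVITY OF `Sb` ON `N(Q)`**: if the extension by zero of `a : S → ℝ` has zero block sums and the quadratic form vanishes, then
`a = 0` on `S`. [folklore] -/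
theorem Sb_strictPos (S : Finset (Fin (d + 1) → ℤ)) (a : (Fin (d + 1) → ℤ) → ℝ)
    (hM : ∀ y, blockSum n (fun x => if x ∈ S then a x else 0) y = 0)
    (h0 : ∑ b ∈ S, ∑ b' ∈ S, a b * a b' * Sb (N := n) b b' = 0) : ∀ b ∈ S, a b = 0 := by
  classical
  obtain ⟨C, _, hbdd, hsum⟩ := lapN_SbCol_bdd_summable (N := n) (d := d)
  obtain ⟨CW, _, hW⟩ := WbAdj_bdd (N := n) (d := d)
  set V := lapColSum (N := n) S a with hVdef
  -- (1) the energy vanishes, so `V = 0`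
  have hVsum : Summable V := by
    have : V = fun x => ∑ b ∈ S, a b * codiff₁ (dz (SbCol (N := n) b)) x := rfl
    rw [this]; exact summable_sum fun b _ => (hsum b).mul_left (a b)
  have hVV : Summable (fun x => V x * V x) := by
    obtain ⟨B, hB⟩ : ∃ B, ∀ x, |V x| ≤ B := ⟨∑ b ∈ S, |a b| * C, fun x => by
      simp only [hVdef, lapColSum]
      calc |∑ b ∈ S, a b * codiff₁ (dz (SbCol (N := n) b)) x|
          ≤ ∑ b ∈ S, |a b * codiff₁ (dz (SbCol (N := n) b)) x| := Finset.abs_sum_le_sum_abs _ _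
        _ ≤ ∑ b ∈ S, |a b| * C := Finset.sum_le_sum fun b _ => by
            rw [abs_mul]; exact mul_le_mul_of_nonneg_left (hbdd _ x) (abs_nonneg _)⟩
    exact summable_mul_of_bdd hB hVsum
  have hV0 : ∀ x, V x = 0 := by
    have hlip : lip0 V V = 0 := by rw [hVdef, ← Sb_form_eq_lip0]; exact h0
    have hhas : HasSum (fun x => V x * V x) 0 := by
      have := hVV.hasSum; unfold lip0 at hlip; rwa [hlip] at this
    have hzero := (hasSum_zero_iff_of_nonneg fun x => mul_self_nonneg (V x)).1 hhas
    intro x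
    have := congrFun hzero x
    simpa using this
  -- (2) apply `L` once more: `ã = −g` with `g = Σ_b a_b W_b`
  set g : (Fin (d + 1) → ℤ) → ℝ := fun x => ∑ b ∈ S, a b * WbAdj (N := n) b x with hgdef
  have hLV : ∀ x, codiff₁ (dz V) x = g x + (if x ∈ S then a x else 0) := by
    intro x
    have e1 : codiff₁ (dz V) x = ∑ b ∈ S, a b * codiff₁ (dz (codiff₁ (dz (SbCol (N := n) b)))) x := lap_finset_sum S a _ x
    rw [e1]
    have e2 : ∀ b ∈ S, a b * codiff₁ (dz (codiff₁ (dz (SbCol (N := n) b)))) x = a b * WbAdj (N := n) b x + a b * δS b x := by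
      intro b _; rw [lapLapN_SbCol]; simp only [Pi.add_apply]; ring
    rw [Finset.sum_congr rfl e2, Finset.sum_add_distrib]
    congr 1
    have e3 : ∀ b ∈ S, a b * δS b x = if x = b then a x else 0 := by
      intro b _; unfold δS; split_ifs with h <;> simp [h]
    rw [Finset.sum_congr rfl e3, Finset.sum_ite_eq]
  have hLV0 : ∀ x, codiff₁ (dz V) x = 0 := by
    intro x
    have hV : V = fun _ => (0 : ℝ) := funext hV0
    rw [hV]; exact lap_zero x
  have hag : ∀ x, (if x ∈ S then a x else 0) = -g x := fun x => by linarith [hLV x, hLV0 x]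
  -- (3) `g` is bounded and block-constant, `ã` is summable with zero block sums: `Σ ã² = −Σ g ã = 0`
  have hgb : ∀ x, |g x| ≤ ∑ b ∈ S, |a b| * CW := fun x => by
    calc |g x| ≤ ∑ b ∈ S, |a b * WbAdj (N := n) b x| := Finset.abs_sum_le_sum_abs _ _
      _ ≤ ∑ b ∈ S, |a b| * CW := Finset.sum_le_sum fun b _ => by
          rw [abs_mul]; exact mul_le_mul_of_nonneg_left (hW b x) (abs_nonneg _)
  have hgc : IsBlockConst n g := by
    intro y r hr
    simp only [hgdef]
    exact Finset.sum_congr rfl fun b _ => by rw [isBlockConst_WbAdj (N := n) b y r hr]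
  have hasum : Summable (fun x => if x ∈ S then a x else 0) :=
    summable_of_ne_finset_zero (s := S) fun x hx => if_neg hx
  have hzero : ∑' x, g x * (if x ∈ S then a x else 0) = 0 := tsum_mul_eq_zero_of_blockConst (N := n) hgb hgc hasum hM
  have hsq : ∑' x, (if x ∈ S then a x else 0) * (if x ∈ S then a x else 0) = 0 := by
    have e : (fun x => (if x ∈ S then a x else 0) * (if x ∈ S then a x else 0)) = fun x => -(g x * (if x ∈ S then a x else 0)) :=
      funext fun x => by rw [hag x]; ring
    rw [e, tsum_neg, hzero, neg_zero]
  -- (4) a finite sum of squares vanishes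
  have hfin : ∑' x, (if x ∈ S then a x else 0) * (if x ∈ S then a x else 0) = ∑ x ∈ S, a x * a x := by
    rw [tsum_eq_sum (s := S) (fun x hx => by simp [hx])]
    exact Finset.sum_congr rfl fun x hx => by simp [hx]
  rw [hfin] at hsq
  intro b hb
  have := (Finset.sum_eq_zero_iff_of_nonneg (fun x _ => mul_self_nonneg (a x))).1 hsq b hb
  exact mul_self_eq_zero.1 this

/-- **COROLLARY — `Sb` IS STRICTLY POSITIVE DEFINITE ON `N(Q) ∩ (finite support)`**: the form is `> 0` unless `a = 0` on `S`. [folklore] -/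
theorem Sb_form_pos (S : Finset (Fin (d + 1) → ℤ)) (a : (Fin (d + 1) → ℤ) → ℝ)
    (hM : ∀ y, blockSum n (fun x => if x ∈ S then a x else 0) y = 0) (ha : ∃ b ∈ S, a b ≠ 0) :
    0 < ∑ b ∈ S, ∑ b' ∈ S, a b * a b' * Sb (N := n) b b' := by
  rcases (Beta.BiLaplaceBlockGreen.Sb_psd (N := n) S a).lt_or_eq with h | h
  · exact h
  · obtain ⟨b, hb, hab⟩ := ha
    exact absurd (Sb_strictPos S a hM h.symm b hb) hab

/-! ## §3 Non-vacuity: `ℤ⁴`, `N = 2` -/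

/-- the statement at `d + 1 = 4`, `N = 2`; the hypotheses are satisfiable (e.g. `S = ∅`, or the source `±1` on two points of one block). -/
example (S : Finset (Fin (3 + 1) → ℤ)) (a : (Fin (3 + 1) → ℤ) → ℝ)
    (hM : ∀ y, blockSum 2 (fun x => if x ∈ S then a x else 0) y = 0)
    (h0 : ∑ b ∈ S, ∑ b' ∈ S, a b * a b' * Sb (N := 2) b b' = 0) : ∀ b ∈ S, a b = 0 :=
  Sb_strictPos S a hM h0

end

end Summit.QuantumFields.BalabanUV.Beta.GAN24.WoodburyFibreSbStrictPos
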